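import Summits.AnomalousDissipation.AnomalousDissipation.Theorems.SteadyCoherentFractionRootsPlanarRefutation
import Summits.AnomalousDissipation.AnomalousDissipation.Theorems.CoherentFractionSpectralHullGlue

/-!
# `TameEulerClimatesPlanar` (stmt-AnomalousDissipation-27427, route CoherentFraction) is FALSE

TEP quantifies over all tame stationary Euler+drift climates; the Dirac mass at the crossed-shear state is one
(`rootsPlanar_of_tameEulerClimatesPlanar : TEP → RootsPlanar`, the lens-4 g19/g22 kernel reduction recopied), and `RootsPlanar` is
false (`…RootsPlanarRefutation`). Class: refuted-SUBSTANTIVE (same witness). Census E31 / lens-4 g22.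
-/

noncomputable section

-- `Summit.<Summit>.<Problem>` is the tree's mandated summit-side namespace (CONVENTIONS §2); for this
-- single-conjunct summit the two segments coincide, so the duplicate is deliberate.
set_option linter.dupNamespace false

namespace Summit.AnomalousDissipation.AnomalousDissipation.Theorems.CrossedShearRoot

open Real MeasureTheory
open scoped InnerProductSpace
open Literature.Analysis.FunctionSpaces Literature.Analysis.FunctionSpaces.Torus Literature.Analysis.FluidPDE

-- adapted from the lens-4 g22 kernel spec CrossedShearRoots.lean (`rootsPlanar_of_TEP`)
/-- `TameEulerClimatesPlanar ⇒ RootsPlanar` (specialise the climate to the Dirac mass `δ_v`). [folklore] -/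
theorem rootsPlanar_of_tameEulerClimatesPlanar
    (h : Summit.AnomalousDissipation.AnomalousDissipation.Theses.CoherentFraction.TameEulerClimatesPlanar) :
    Summit.AnomalousDissipation.AnomalousDissipation.Theses.SteadyCoherentFraction.RootsPlanar := by
  haveI := SpectralHullGlue.measurableSingletonClass_energySpace
  intro m R v hR hstat
  have hae := h m R (MeasureTheory.Measure.dirac v) inferInstance
    (by rw [MeasureTheory.ae_dirac_eq]; exact Filter.eventually_pure.mpr hR)
    (fun Φ => by rw [MeasureTheory.integral_dirac]; exact hstat Φ)
  rw [MeasureTheory.ae_dirac_eq] at hae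
  exact Filter.eventually_pure.mp hae

/-- **KILL: `TameEulerClimatesPlanar` (stmt-AnomalousDissipation-27427, route CoherentFraction) is FALSE.**
CLASS: refuted-SUBSTANTIVE. WITNESS: the Dirac climate `δ_W` at the crossed-shear / reciprocal-shear root `W`
(`A = 1`, `ε = 1`, `1/r = 1 + ½cos 2πx₂`, `m = c_K e₁`, `c_K = −1/(4π)`; `…RootsPlanarRefutation`): TEP ⟹ RootsPlanar
(`rootsPlanar_of_tameEulerClimatesPlanar`, Dirac specialisation) and `¬RootsPlanar`. NO CHEAP REPAIR: as for
`RootsPlanar` (laminar-proximity and small-enstrophy side conditions fail on the same family; finite type = item 27870).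
Barrier-candidate: «reciprocal-shear modulation». Credit: census memo d24a2b45f95a45a5, lens-4 g22 spec a0e7b9766f80b4f9.
[folklore] -/
theorem not_tameEulerClimatesPlanar :
    ¬ Summit.AnomalousDissipation.AnomalousDissipation.Theses.CoherentFraction.TameEulerClimatesPlanar :=
  fun h => not_rootsPlanar (rootsPlanar_of_tameEulerClimatesPlanar h)

end Summit.AnomalousDissipation.AnomalousDissipation.Theorems.CrossedShearRoot

end
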